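import Summits.QuantumFields.BalabanUV.Beta.GAN24.AliasFibreBridge

/-!
# `BalabanUV.Beta.GAN24.ZeroAliasBounds` — binder row G-an2-4 / (CONV-C), road P1-fibre (toward p1's L10, (U1) near `p = 0`): the ZERO-ALIAS DATA on a COMPLEX
# ball `‖p_κ‖ ≤ r ≤ 1/2` — symbols small (`L_0 = O(r²/N²)`, `∂̂(k_0) = O(r/N)`), pinning weights large (`S(0) ≳ N^D`, `χ̂_0 ≳ 1`, `s♭_κ(0) ≳ N`), uniformly in `N`

NOT IN PRINT; OUR PROOF ATTEMPT.  HONEST FRAMING (cell contract, verbatim): «discharging `BetaPertH` makes Bałaban's UV stability UNCONDITIONAL — a real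
constructive-QFT result; it is NOT the continuum limit and NOT the Clay problem.»  HONEST DEPENDENCY (verbatim): «continuum YM on T⁴ ⇐ BetaPertH ∧ nine spine
estimates (0/9 proved); BetaPertH ⇐ (D1) ∧ (D4) ∧ CAP+tail; G-an2-4 gates asym, D1 and NE2/3/4.»  [folklore] elementary estimates of geometric sums at COMPLEX momenta
(no cited fact, no wall binder, no `def`).  NOT summit progress; nothing of (CONV-C)'s K-slot is discharged here.

## What is proved (generic `D`, `N ≥ 1`, complex `p` with `‖p_κ‖ ≤ r`, `r ≤ 1/2` — a ball, so every strip point near `0` included)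
* §1 `norm_cexp_sub_one_le'`, **`norm_gs_sub_le`**: `‖gs z N − N‖ ≤ r·N` when `‖z‖·N ≤ r ≤ 1` (Mathlib `Complex.norm_exp_sub_one_le`), hence `‖gs z N‖ ≥ (1 − r)·N`
  (`norm_gs_ge`); the zero-alias momentum `kFine p 0 = p/N` (`kFine_zero_apply`, `norm_kFine_zero_mul`).
* §2 THE SEVEN INPUTS OF `ZeroAliasPinning.pinning` for the zero alias, in `FibreArrow` currency (via `AliasFibreBridge`): `‖dhat (kFine p 0) κ‖ ≤ 2r/N`,
  `‖dflat (kFine p 0) κ‖ ≤ 2r/N`, `‖lapSym (kFine p 0)‖ ≤ 4Dr²/N²`; `‖boxS p 0‖ ≥ ((1−r)N)^D`, `‖boxSs p 0 κ‖ ≥ ((1−r)N)^{D+1}`, `‖chiHat p 0‖ ≥ (1−r)^D`,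
  `‖chiHat p 0 · sflat p 0 κ‖ ≥ (1−r)^{D+1}·N`.  With `r ≤ 1/2`: weights `≥ N^D/2^D`, `N^{D+1}/2^{D+1}`, `2^{−D}`, `N/2^{D+1}` — the `e, g, q, m` of the pinning lemma with
  every power of `N` as predicted (`ℓ = 4Dr²/N²`, `δ = 2r/N`).
Unit `b2b-balaban-gan24-formalise-leaf-06` (G-an2-4 formalisation swarm), 2026-08-20.
-/

noncomputable section

open Complex Finset
open scoped BigOperators Real
open Literature.MathematicalPhysics.QuantumFieldTheory.Balaban1983to89.Beta
open Literature.MathematicalPhysics.QuantumFieldTheory.LatticeForm (repZ)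
open Literature.Probability.LatticeModels (TorusSite)
open BlochFibreMatrix (repZ_zero)
open Summit.QuantumFields.BalabanUV.Beta.GAN24.FibreSymbols (dhat dflat lapSym)
open Summit.QuantumFields.BalabanUV.Beta.GAN24.FibreDFT (kFine)
open Summit.QuantumFields.BalabanUV.Beta.GAN24.FibreArrow (chiHat sflat boxS boxSs)
open Summit.QuantumFields.BalabanUV.Beta.GAN24.AliasObjects (kAl gs sAl SAl sbAl SbAl chiAl)
open Summit.QuantumFields.BalabanUV.Beta.GAN24.AliasFibreBridge (sflat_eq_sbAl boxS_eq_SAl chiHat_eq_chiAl boxSs_eq_SAl_mul_sAl)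

namespace Summit.QuantumFields.BalabanUV.Beta.GAN24.ZeroAliasBounds

variable {D N : ℕ} [NeZero N]

/-! ## §1 Geometric sums at small complex momentum -/

/-- [folklore] Gauss: `2·Σ_{t<n} t = n(n−1)` over `ℝ`. -/
theorem sum_range_cast_mul_two (n : ℕ) : (2 : ℝ) * ∑ t ∈ Finset.range n, (t : ℝ) = n * (n - 1) := by
  induction n with
  | zero => simp
  | succ k ih => rw [Finset.sum_range_succ, mul_add, ih]; push_cast; ring

omit [NeZero N] in
/-- [folklore] **`‖gs z N − N‖ ≤ r·N`** when `‖z‖·N ≤ r ≤ 1`: every term `e^{izt}`, `t < N`, is within `2‖z‖t ≤ 2r·t/N` of `1`. -/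
theorem norm_gs_sub_le {z : ℂ} {r : ℝ} (hz : ‖z‖ * N ≤ r) (hr : r ≤ 1) : ‖gs z N - N‖ ≤ r * N := by
  have hr0 : 0 ≤ r := le_trans (by positivity) hz
  unfold gs
  have hN : ((N : ℂ)) = ∑ _t ∈ Finset.range N, (1 : ℂ) := by simp
  rw [hN, ← Finset.sum_sub_distrib]
  have hterm : ∀ t ∈ Finset.range N, ‖cexp (I * z * t) - 1‖ ≤ 2 * (‖z‖ * t) := by
    intro t ht
    have htN : (t : ℝ) ≤ N := by exact_mod_cast (Finset.mem_range.mp ht).le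
    have hx : ‖I * z * t‖ ≤ 1 := by
      rw [norm_mul, norm_mul, Complex.norm_I, one_mul, Complex.norm_natCast]
      calc ‖z‖ * t ≤ ‖z‖ * N := mul_le_mul_of_nonneg_left htN (norm_nonneg _)
        _ ≤ r := hz
        _ ≤ 1 := hr
    have := Complex.norm_exp_sub_one_le hx
    rwa [norm_mul, norm_mul, Complex.norm_I, one_mul, Complex.norm_natCast] at this
  calc ‖∑ t ∈ Finset.range N, (cexp (I * z * t) - 1)‖ ≤ ∑ t ∈ Finset.range N, ‖cexp (I * z * t) - 1‖ := norm_sum_le _ _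
    _ ≤ ∑ t ∈ Finset.range N, 2 * (‖z‖ * t) := Finset.sum_le_sum hterm
    _ = ‖z‖ * (2 * ∑ t ∈ Finset.range N, (t : ℝ)) := by rw [Finset.mul_sum, Finset.mul_sum]; exact Finset.sum_congr rfl fun t _ => by ring
    _ ≤ ‖z‖ * ((N : ℝ) * N) := by
        apply mul_le_mul_of_nonneg_left _ (norm_nonneg _)
        rw [sum_range_cast_mul_two]
        nlinarith [Nat.cast_nonneg (α := ℝ) N]
    _ = (‖z‖ * N) * N := by ring
    _ ≤ r * N := mul_le_mul_of_nonneg_right hz (Nat.cast_nonneg N)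

omit [NeZero N] in
/-- [folklore] … hence `‖gs z N‖ ≥ (1 − r)·N`. -/
theorem norm_gs_ge {z : ℂ} {r : ℝ} (hz : ‖z‖ * N ≤ r) (hr : r ≤ 1) : (1 - r) * N ≤ ‖gs z N‖ := by
  have h := norm_gs_sub_le (N := N) hz hr
  have h2 : ‖(N : ℂ)‖ - ‖gs z N - N‖ ≤ ‖gs z N‖ := by
    have := norm_sub_norm_le (N : ℂ) ((N : ℂ) - gs z N)
    rw [sub_sub_cancel, norm_sub_rev] at this
    linarith
  rw [Complex.norm_natCast] at h2
  linarith

omit [NeZero N] in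
/-- [folklore] The zero alias sits at `k_0 = p/N`. -/
theorem kFine_zero_apply (p : Fin D → ℂ) (κ : Fin D) : kFine p (0 : TorusSite D N) κ = p κ / N := by
  simp [kFine, repZ_zero]

/-- [folklore] `‖k_{0,κ}‖·N = ‖p_κ‖`. -/
theorem norm_kFine_zero_mul (p : Fin D → ℂ) (κ : Fin D) : ‖kFine p (0 : TorusSite D N) κ‖ * N = ‖p κ‖ := by
  have hN : (N : ℝ) ≠ 0 := Nat.cast_ne_zero.mpr (NeZero.ne N)
  rw [kFine_zero_apply, norm_div, Complex.norm_natCast, div_mul_cancel₀ _ hN]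

/-- [folklore] `‖−k‖·N = ‖k‖·N`. -/
theorem norm_neg_kFine_zero_mul (p : Fin D → ℂ) (κ : Fin D) : ‖-kFine p (0 : TorusSite D N) κ‖ * N = ‖p κ‖ := by
  rw [norm_neg, norm_kFine_zero_mul]

/-! ## §2 The seven inputs of the pinning lemma -/

section Ball

variable {p : Fin D → ℂ} {r : ℝ}

/-- [folklore] `‖∂̂_κ(k_0)‖ ≤ 2r/N`. -/
theorem norm_dhat_zero_le (hp : ∀ κ, ‖p κ‖ ≤ r) (hr : r ≤ 1) (κ : Fin D) : ‖dhat (kFine p (0 : TorusSite D N)) κ‖ ≤ 2 * r / N := by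
  have hN0 : (0 : ℝ) < N := by exact_mod_cast Nat.pos_of_ne_zero (NeZero.ne N)
  have hx : ‖I * kFine p (0 : TorusSite D N) κ‖ ≤ 1 := by
    rw [norm_mul, Complex.norm_I, one_mul, kFine_zero_apply, norm_div, Complex.norm_natCast, div_le_one hN0]
    exact (hp κ).trans (hr.trans (by exact_mod_cast Nat.one_le_iff_ne_zero.mpr (NeZero.ne N)))
  unfold dhat
  calc ‖cexp (I * kFine p 0 κ) - 1‖ ≤ 2 * ‖I * kFine p (0 : TorusSite D N) κ‖ := Complex.norm_exp_sub_one_le hx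
    _ = 2 * (‖p κ‖ / N) := by rw [norm_mul, Complex.norm_I, one_mul, kFine_zero_apply, norm_div, Complex.norm_natCast]
    _ ≤ 2 * r / N := by rw [mul_div_assoc]; exact mul_le_mul_of_nonneg_left (div_le_div_of_nonneg_right (hp κ) hN0.le) zero_le_two

/-- [folklore] `‖∂̂♭_κ(k_0)‖ ≤ 2r/N`. -/
theorem norm_dflat_zero_le (hp : ∀ κ, ‖p κ‖ ≤ r) (hr : r ≤ 1) (κ : Fin D) : ‖dflat (kFine p (0 : TorusSite D N)) κ‖ ≤ 2 * r / N := by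
  have hN0 : (0 : ℝ) < N := by exact_mod_cast Nat.pos_of_ne_zero (NeZero.ne N)
  have hx : ‖-(I * kFine p (0 : TorusSite D N) κ)‖ ≤ 1 := by
    rw [norm_neg, norm_mul, Complex.norm_I, one_mul, kFine_zero_apply, norm_div, Complex.norm_natCast, div_le_one hN0]
    exact (hp κ).trans (hr.trans (by exact_mod_cast Nat.one_le_iff_ne_zero.mpr (NeZero.ne N)))
  unfold dflat
  calc ‖cexp (-(I * kFine p 0 κ)) - 1‖ ≤ 2 * ‖-(I * kFine p (0 : TorusSite D N) κ)‖ := Complex.norm_exp_sub_one_le hx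
    _ = 2 * (‖p κ‖ / N) := by rw [norm_neg, norm_mul, Complex.norm_I, one_mul, kFine_zero_apply, norm_div, Complex.norm_natCast]
    _ ≤ 2 * r / N := by rw [mul_div_assoc]; exact mul_le_mul_of_nonneg_left (div_le_div_of_nonneg_right (hp κ) hN0.le) zero_le_two

/-- [folklore] `‖L_0‖ ≤ 4Dr²/N²`. -/
theorem norm_lapSym_zero_le (hp : ∀ κ, ‖p κ‖ ≤ r) (hr0 : 0 ≤ r) (hr : r ≤ 1) :
    ‖lapSym (kFine p (0 : TorusSite D N))‖ ≤ 4 * D * r ^ 2 / (N : ℝ) ^ 2 := by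
  have hN0 : (0 : ℝ) < N := by exact_mod_cast Nat.pos_of_ne_zero (NeZero.ne N)
  unfold lapSym
  calc ‖∑ κ, dhat (kFine p 0) κ * dflat (kFine p 0) κ‖ ≤ ∑ κ, ‖dhat (kFine p (0 : TorusSite D N)) κ * dflat (kFine p 0) κ‖ := norm_sum_le _ _
    _ ≤ ∑ _κ : Fin D, (2 * r / N) * (2 * r / N) := Finset.sum_le_sum fun κ _ => by
        rw [norm_mul]
        exact mul_le_mul (norm_dhat_zero_le hp hr κ) (norm_dflat_zero_le hp hr κ) (norm_nonneg _) (by positivity)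
    _ = 4 * D * r ^ 2 / (N : ℝ) ^ 2 := by
        rw [Finset.sum_const, Finset.card_univ, Fintype.card_fin, nsmul_eq_mul]; field_simp; ring

/-- [folklore] Each zero-alias geometric factor is `≥ (1−r)N` in modulus (`±` momentum). -/
theorem norm_gs_kFine_zero_ge (hp : ∀ κ, ‖p κ‖ ≤ r) (hr : r ≤ 1) (κ : Fin D) :
    (1 - r) * N ≤ ‖gs (kFine p (0 : TorusSite D N) κ) N‖ :=
  norm_gs_ge (by rw [norm_kFine_zero_mul]; exact hp κ) hr

/-- [folklore] … and the reflected one. -/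
theorem norm_gs_neg_kFine_zero_ge (hp : ∀ κ, ‖p κ‖ ≤ r) (hr : r ≤ 1) (κ : Fin D) :
    (1 - r) * N ≤ ‖gs (-kFine p (0 : TorusSite D N) κ) N‖ :=
  norm_gs_ge (by rw [norm_neg_kFine_zero_mul]; exact hp κ) hr

/-- [folklore] **`‖S(0)‖ ≥ ((1−r)N)^D`** — the M-row pinning weight `wM⁰ = boxS p 0`. -/
theorem norm_boxS_zero_ge (hp : ∀ κ, ‖p κ‖ ≤ r) (hr : r ≤ 1) : ((1 - r) * N) ^ D ≤ ‖boxS p (0 : TorusSite D N)‖ := by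
  rw [boxS_eq_SAl, SAl, norm_prod]
  have hc : ((1 - r) * N) ^ D = ∏ _i : Fin D, ((1 - r) * (N : ℝ)) := by
    rw [Finset.prod_const, Finset.card_univ, Fintype.card_fin]
  rw [hc]
  have h0 : 0 ≤ (1 - r) * (N : ℝ) := mul_nonneg (by linarith) (Nat.cast_nonneg N)
  exact Finset.prod_le_prod (fun i _ => h0) fun i _ => norm_gs_kFine_zero_ge hp hr i

/-- [folklore] **`‖S(0)·s_κ(0)‖ ≥ ((1−r)N)^{D+1}`** — the Q-row pinning weights `wQ⁰_κ = boxSs p 0 κ`. -/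
theorem norm_boxSs_zero_ge (hp : ∀ κ, ‖p κ‖ ≤ r) (hr : r ≤ 1) (κ : Fin D) :
    ((1 - r) * N) ^ (D + 1) ≤ ‖boxSs p (0 : TorusSite D N) κ‖ := by
  rw [boxSs_eq_SAl_mul_sAl, norm_mul, pow_succ, ← boxS_eq_SAl]
  have h0 : 0 ≤ (1 - r) * (N : ℝ) := mul_nonneg (by linarith) (Nat.cast_nonneg N)
  exact mul_le_mul (norm_boxS_zero_ge hp hr) (norm_gs_kFine_zero_ge hp hr κ) h0 (norm_nonneg _)

/-- [folklore] `‖S♭(0)‖ ≥ ((1−r)N)^D`. -/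
theorem norm_SbAl_zero_ge (hp : ∀ κ, ‖p κ‖ ≤ r) (hr : r ≤ 1) : ((1 - r) * N) ^ D ≤ ‖SbAl N p (0 : TorusSite D N)‖ := by
  rw [SbAl, norm_prod]
  have hc : ((1 - r) * N) ^ D = ∏ _i : Fin D, ((1 - r) * (N : ℝ)) := by
    rw [Finset.prod_const, Finset.card_univ, Fintype.card_fin]
  rw [hc]
  have h0 : 0 ≤ (1 - r) * (N : ℝ) := mul_nonneg (by linarith) (Nat.cast_nonneg N)
  exact Finset.prod_le_prod (fun i _ => h0) fun i _ => norm_gs_neg_kFine_zero_ge hp hr i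

/-- [folklore] **`‖χ̂_0‖ ≥ (1−r)^D`** — the G-row pinning weight `wG⁰ = chiHat p 0`. -/
theorem norm_chiHat_zero_ge (hp : ∀ κ, ‖p κ‖ ≤ r) (hr : r ≤ 1) : (1 - r) ^ D ≤ ‖chiHat p (0 : TorusSite D N)‖ := by
  have hN0 : (0 : ℝ) < N := by exact_mod_cast Nat.pos_of_ne_zero (NeZero.ne N)
  rw [chiHat_eq_chiAl, chiAl, norm_div, norm_pow, Complex.norm_natCast, le_div_iff₀ (by positivity)]
  calc (1 - r) ^ D * (N : ℝ) ^ D = ((1 - r) * N) ^ D := by rw [mul_pow]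
    _ ≤ ‖SbAl N p (0 : TorusSite D N)‖ := norm_SbAl_zero_ge hp hr

/-- [folklore] **`‖χ̂_0 s♭_κ(0)‖ ≥ (1−r)^{D+1} N`** — the EL-row pinning weights `wE⁰_κ = chiHat p 0 * sflat p 0 κ`. -/
theorem norm_wE_zero_ge (hp : ∀ κ, ‖p κ‖ ≤ r) (hr : r ≤ 1) (κ : Fin D) :
    (1 - r) ^ (D + 1) * N ≤ ‖chiHat p (0 : TorusSite D N) * sflat p (0 : TorusSite D N) κ‖ := by
  rw [norm_mul, sflat_eq_sbAl, sbAl, pow_succ, mul_assoc]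
  have h1 : 0 ≤ (1 - r) := by linarith
  exact mul_le_mul (norm_chiHat_zero_ge hp hr) (norm_gs_neg_kFine_zero_ge hp hr κ) (mul_nonneg h1 (Nat.cast_nonneg N)) (norm_nonneg _)

end Ball

end Summit.QuantumFields.BalabanUV.Beta.GAN24.ZeroAliasBounds

end
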